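import Summits.ABC.ABC.Theorems.TwistAmplificationSharpModerateLawCuspTransfer

/-!
# Crux `TwistAmplification.SharpModerateLaw` (stmt-ABC-1975), line `deep-moduli-cusp-dispersion`:
the transfer stub `stub_cuspTransfer` (C⁺′ = `CuspLawD` ⇒ `SharpModerateLaw`)

The line's transfer target C⁺′ is a counting law for the DYADIC cusp set `cuspSetD X Y` of pairs
`(u, v) = (c₄, c₆) ∈ ℤ²` with `uv ≠ 0`, `u³ ≠ v²`, `1728 ∣ u³ − v²`, tower-free, level
`M⁺ = max(|u|³, |u³ − v²|/1728) ∈ (Y/2, Y]` and conductor proxy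
`N* = ∏_{p ∣ Δ} (p² if p ∣ u else p) ≤ X` (ALL primes of `Δ = (u³ − v²)/1728`, including `2, 3`),
valid on the cone `X³ ≤ 8Y ≤ 8X^σ`.  This file proves that C⁺′ implies the crux, along the lines of the
sister transfer `cuspTransferCone` (`…CuspTransferCone.lean`):
* `N* ∣ N` for a model minimal at every place (`nstar_dvd_conductorNorm`: `f_p ≥ 1` at `p ∣ Δ`,
  `f_p ≥ 2` at `p ∣ Δ`, `p ∣ c₄`, at every prime);
* a window model (`N ≤ X`, `N^κ ≤ M⁺ ≤ N^σ`) with `j = ⌊log₂ M⁺⌋` has `(c₄, c₆)` in the dyadic cusp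
  set at the scales `X_j = min(X', 2^{(j+1)/κ})`, `Y_j = 2^{j+1} − 1`, `X' = max(X, 2)`, and these
  scales lie in the cone `X_j³ ≤ 8Y_j`, `Y_j ≤ X_j^{σ+1}` for EVERY `j ≤ ⌊log₂ ⌊X'^σ⌋⌋`;
* the fibres of `W₀ ↦ (a₁, a₂, a₃, c₄, c₆)` are points (`model_injective`), `12` reduced triples;
* per shell `X_j Y_j^{-1/6} + 1 ≤ 3X'^{1−κ/6}` (`shell_main_le`, where `κ < 6` enters), and the
  `≪ σ log X'` shells and `X_j^{ε/2} ≤ X'^{ε/2}` are absorbed into `X'^ε ≤ 2^{…} X^ε`.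
-/

noncomputable section

namespace Summit.ABC.ABC.Theorems.SharpModerateLaw.DeepModuli

open WeierstrassCurve IsDedekindDomain Rat.HeightOneSpectrum Real

/-! ## 1. The conductor proxy `N*` of a minimal model divides the conductor -/

section Model

variable {W : WeierstrassCurve ℤ}

/-- **`N* ∣ N`**: for a model minimal at every place, `∏_{p ∣ Δ} (p² if p ∣ c₄ else p)` divides the
conductor (`f_p ≥ 1` at `p ∣ Δ`; `f_p ≥ 2` at `p ∣ Δ`, `p ∣ c₄`; B–G 12.5.9, every prime). -/
theorem nstar_dvd_conductorNorm [(W.baseChange ℚ).IsElliptic]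
    (hmin : ∀ v : HeightOneSpectrum ℤ, (W.baseChange ℚ).IsMinimalAt v) :
    (∏ p ∈ W.Δ.natAbs.primeFactors, (if ((p : ℕ) : ℤ) ∣ W.c₄ then p ^ 2 else p)) ∣
      (W.baseChange ℚ).conductorNorm ℤ := by
  have hN0 : (W.baseChange ℚ).conductorNorm ℤ ≠ 0 := (conductorNorm_pos_holds _).ne'
  have hconv : ∀ p ∈ W.Δ.natAbs.primeFactors,
      (if ((p : ℕ) : ℤ) ∣ W.c₄ then p ^ 2 else p) = p ^ (if ((p : ℕ) : ℤ) ∣ W.c₄ then 2 else 1) := by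
    intro p _
    split_ifs <;> simp
  rw [Finset.prod_congr rfl hconv]
  refine Literature.NumberTheory.EllipticCurves.SzpiroOfAbc.prod_prime_pow_dvd
    (fun p hp => Nat.prime_of_mem_primeFactors hp) _ ?_
  intro p hpF
  have hpp : p.Prime := Nat.prime_of_mem_primeFactors hpF
  have hpΔ : (p : ℤ) ∣ W.Δ := Int.ofNat_dvd_left.mpr (Nat.dvd_of_mem_primeFactors hpF)
  set v : HeightOneSpectrum ℤ := (primesEquiv (R := ℤ)).symm ⟨p, hpp⟩ with hv
  have hgen : natGenerator v = p :=
    Literature.NumberTheory.EllipticCurves.Rat.natGenerator_primesEquiv_symm ⟨p, hpp⟩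
  have hfac : ((W.baseChange ℚ).conductorNorm ℤ).factorization p = (W.baseChange ℚ).conductorExponent v :=
    factorization_conductorNorm_primesEquiv_symm _ ⟨p, hpp⟩
  refine (hpp.pow_dvd_iff_le_factorization hN0).mpr ?_
  rw [hfac]
  split_ifs with hc
  · exact two_le_conductorExponent_of_dvd_Δ_of_dvd_c₄ (hmin v) (by rw [hgen]; exact hpΔ)
      (by rw [hgen]; exact hc)
  · exact Nat.one_le_iff_ne_zero.mpr (conductorExponent_ne_zero_of_dvd_Δ (hmin v) (by rw [hgen]; exact hpΔ))

/-- `N*(c₄, c₆) ≤ N` as real numbers, with `Δ` written as `(c₄³ − c₆²)/1728`. -/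
theorem nstar_le_conductorNorm [(W.baseChange ℚ).IsElliptic]
    (hmin : ∀ v : HeightOneSpectrum ℤ, (W.baseChange ℚ).IsMinimalAt v) :
    ((∏ p ∈ ((W.c₄ ^ 3 - W.c₆ ^ 2) / 1728).natAbs.primeFactors,
        (if ((p : ℕ) : ℤ) ∣ W.c₄ then p ^ 2 else p) : ℕ) : ℝ) ≤
      (((W.baseChange ℚ).conductorNorm ℤ : ℕ) : ℝ) := by
  rw [c₄_cube_sub_c₆_sq_ediv]
  exact_mod_cast Nat.le_of_dvd (conductorNorm_pos_holds _) (nstar_dvd_conductorNorm hmin)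

/-- A minimal model with `c₄c₆ ≠ 0` lands in the dyadic cusp set at any scales `(X₀, Y₀)` with
`N ≤ X₀` and `M⁺ ≤ Y₀ < 2M⁺` (`M⁺ = Mcusp (c₄, c₆) = max(|Δ|, |c₄|³)`). -/
theorem mem_cuspSetD_of_window {X₀ Y₀ : ℝ} [(W.baseChange ℚ).IsElliptic]
    (hmin : ∀ v : HeightOneSpectrum ℤ, (W.baseChange ℚ).IsMinimalAt v) (hc₄ : W.c₄ ≠ 0) (hc₆ : W.c₆ ≠ 0)
    (hNX : (((W.baseChange ℚ).conductorNorm ℤ : ℕ) : ℝ) ≤ X₀)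
    (hMY : ((Mcusp (W.c₄, W.c₆) : ℕ) : ℝ) ≤ Y₀) (hYM : Y₀ < 2 * ((Mcusp (W.c₄, W.c₆) : ℕ) : ℝ)) :
    W.c₄ ≠ 0 ∧ W.c₆ ≠ 0 ∧ W.c₄ ^ 3 ≠ W.c₆ ^ 2 ∧ (1728 : ℤ) ∣ W.c₄ ^ 3 - W.c₆ ^ 2 ∧
      ((∀ p : ℕ, p.Prime → 5 ≤ p → ¬ ((p : ℤ) ^ 4 ∣ W.c₄ ∧ (p : ℤ) ^ 6 ∣ W.c₆)) ∧
        ¬ ((2 : ℤ) ^ 8 ∣ W.c₄ ∧ (2 : ℤ) ^ 11 ∣ W.c₆) ∧ ¬ ((3 : ℤ) ^ 5 ∣ W.c₄ ∧ (3 : ℤ) ^ 9 ∣ W.c₆)) ∧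
      ((|W.c₄| ^ 3 : ℤ) : ℝ) ≤ Y₀ ∧ ((|W.c₄ ^ 3 - W.c₆ ^ 2| : ℤ) : ℝ) ≤ 1728 * Y₀ ∧
      Y₀ < 2 * max (((|W.c₄| ^ 3 : ℤ) : ℝ)) (((|W.c₄ ^ 3 - W.c₆ ^ 2| : ℤ) : ℝ) / 1728) ∧
      ((∏ p ∈ ((W.c₄ ^ 3 - W.c₆ ^ 2) / 1728).natAbs.primeFactors,
          (if ((p : ℕ) : ℤ) ∣ W.c₄ then p ^ 2 else p) : ℕ) : ℝ) ≤ X₀ := by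
  have hΔ : W.Δ ≠ 0 := Δ_ne_zero_of_isElliptic_baseChange_int W
  have hMreal : ((Mcusp (W.c₄, W.c₆) : ℕ) : ℝ) = ((max |W.Δ| (|W.c₄| ^ 3) : ℤ) : ℝ) := cast_Mcusp_eq W
  have hrel : W.c₄ ^ 3 - W.c₆ ^ 2 = 1728 * W.Δ := c₄_cube_sub_c₆_sq W
  have habs : ((|W.c₄ ^ 3 - W.c₆ ^ 2| : ℤ) : ℝ) = 1728 * ((|W.Δ| : ℤ) : ℝ) := by
    rw [hrel, abs_mul]
    push_cast
    norm_num
  have hmax : max (((|W.c₄| ^ 3 : ℤ) : ℝ)) (((|W.c₄ ^ 3 - W.c₆ ^ 2| : ℤ) : ℝ) / 1728) =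
      ((Mcusp (W.c₄, W.c₆) : ℕ) : ℝ) := by
    rw [hMreal, habs, max_comm]
    push_cast
    congr 1
    ring
  refine ⟨hc₄, hc₆, ?_, ⟨W.Δ, hrel⟩, tf_of_isMinimalAt hΔ hmin, ?_, ?_, ?_, ?_⟩
  · intro h
    have : (1728 : ℤ) * W.Δ = 0 := by rw [← hrel, h, sub_self]
    exact hΔ (by simpa using this)
  · calc ((|W.c₄| ^ 3 : ℤ) : ℝ) ≤ ((max |W.Δ| (|W.c₄| ^ 3) : ℤ) : ℝ) := by
          exact_mod_cast le_max_right _ _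
      _ = ((Mcusp (W.c₄, W.c₆) : ℕ) : ℝ) := hMreal.symm
      _ ≤ Y₀ := hMY
  · rw [habs]
    have h1 : ((|W.Δ| : ℤ) : ℝ) ≤ ((max |W.Δ| (|W.c₄| ^ 3) : ℤ) : ℝ) := by
      exact_mod_cast le_max_left _ _
    rw [← hMreal] at h1
    linarith
  · rw [hmax]; exact hYM
  · exact (nstar_le_conductorNorm hmin).trans hNX

end Model

/-! ## 2. Finiteness of the dyadic cusp sets -/

/-- The dyadic cusp set at level `Y ≥ 1` is finite (`|u| ≤ |u|³ ≤ Y`, `v² ≤ |u|³ + |u³ − v²| ≤ 1729Y`). -/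
theorem cuspSetD_finite (X Y : ℝ) (hY : 1 ≤ Y) :
    {x : ℤ × ℤ | x.1 ≠ 0 ∧ x.2 ≠ 0 ∧ x.1 ^ 3 ≠ x.2 ^ 2 ∧ (1728 : ℤ) ∣ x.1 ^ 3 - x.2 ^ 2 ∧
        ((∀ p : ℕ, p.Prime → 5 ≤ p → ¬ ((p : ℤ) ^ 4 ∣ x.1 ∧ (p : ℤ) ^ 6 ∣ x.2)) ∧
          ¬ ((2 : ℤ) ^ 8 ∣ x.1 ∧ (2 : ℤ) ^ 11 ∣ x.2) ∧ ¬ ((3 : ℤ) ^ 5 ∣ x.1 ∧ (3 : ℤ) ^ 9 ∣ x.2)) ∧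
        ((|x.1| ^ 3 : ℤ) : ℝ) ≤ Y ∧ ((|x.1 ^ 3 - x.2 ^ 2| : ℤ) : ℝ) ≤ 1728 * Y ∧
        Y < 2 * max (((|x.1| ^ 3 : ℤ) : ℝ)) (((|x.1 ^ 3 - x.2 ^ 2| : ℤ) : ℝ) / 1728) ∧
        ((∏ p ∈ ((x.1 ^ 3 - x.2 ^ 2) / 1728).natAbs.primeFactors,
            (if ((p : ℕ) : ℤ) ∣ x.1 then p ^ 2 else p) : ℕ) : ℝ) ≤ X}.Finite := by
  have hY' : (1 : ℝ) ≤ 1729 * Y := by linarith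
  set N : ℕ := Nat.ceil (1729 * Y) with hN
  have hYN : 1729 * Y ≤ N := Nat.le_ceil _
  -- `|z|³ ≤ T`, `T ≥ 1` ⇒ `|z| ≤ T`; `z² ≤ T`, `T ≥ 1` ⇒ `|z| ≤ T`
  have cube_le : ∀ {z : ℝ}, |z| ^ 3 ≤ 1729 * Y → |z| ≤ 1729 * Y := by
    intro z h
    rcases le_or_gt |z| 1 with h1 | h1
    · exact h1.trans hY'
    · have h2 : 0 ≤ |z| * (|z| ^ 2 - 1) := mul_nonneg (abs_nonneg _) (by nlinarith)
      nlinarith [h2]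
  have sq_le : ∀ {z : ℝ}, z ^ 2 ≤ 1729 * Y → |z| ≤ 1729 * Y := by
    intro z h
    rcases le_or_gt |z| 1 with h1 | h1
    · exact h1.trans hY'
    · have h2 : 0 ≤ |z| * (|z| - 1) := mul_nonneg (abs_nonneg _) (by linarith)
      have h3 : |z| ^ 2 = z ^ 2 := sq_abs z
      nlinarith [h2, h3]
  refine (Set.Finite.prod (Set.finite_Icc (-(N : ℤ)) N) (Set.finite_Icc (-(N : ℤ)) N)).subset ?_
  rintro ⟨x, y⟩ ⟨-, -, -, -, -, hx, hxy, -, -⟩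
  simp only [Set.mem_prod, Set.mem_Icc]
  have h3 : (((|x| ^ 3 : ℤ)) : ℝ) = |(x : ℝ)| ^ 3 := by push_cast; rfl
  have h4 : |(x : ℝ)| ^ 3 ≤ Y := h3 ▸ hx
  have hx1 : |(x : ℝ)| ^ 3 ≤ 1729 * Y := by
    have h0 : 0 ≤ Y := by linarith
    linarith
  have hx' : |(x : ℝ)| ≤ N := (cube_le hx1).trans hYN
  have hy1 : (y : ℝ) ^ 2 ≤ 1729 * Y := by
    have e : (((|x ^ 3 - y ^ 2| : ℤ)) : ℝ) = |(x : ℝ) ^ 3 - (y : ℝ) ^ 2| := by push_cast; rfl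
    have h1 : |(x : ℝ) ^ 3 - (y : ℝ) ^ 2| ≤ 1728 * Y := e ▸ hxy
    have h2 : (x : ℝ) ^ 3 ≤ |(x : ℝ)| ^ 3 := by
      rw [← abs_pow]; exact le_abs_self _
    have h5 := (abs_le.mp h1).1
    nlinarith
  have hy' : |(y : ℝ)| ≤ N := (sq_le hy1).trans hYN
  have hx'' : |x| ≤ (N : ℤ) := by exact_mod_cast hx'
  have hy'' : |y| ≤ (N : ℤ) := by exact_mod_cast hy'
  exact ⟨⟨(abs_le.mp hx'').1, (abs_le.mp hx'').2⟩, ⟨(abs_le.mp hy'').1, (abs_le.mp hy'').2⟩⟩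

/-! ## 3. The stub -/

/-- **`stub_cuspTransfer`** (line `deep-moduli-cusp-dispersion`): the dyadic cusp law C⁺′ = `CuspLawD`
on the cone `X³ ≤ 8Y ≤ 8X^σ` implies the crux `SharpModerateLaw`. -/
theorem stub_cuspTransfer :
    (∀ σ : ℝ, 6 < σ → ∀ ε : ℝ, 0 < ε → ∃ C : ℝ, ∀ X Y : ℝ, 1 ≤ X → 1 ≤ Y → X ^ 3 ≤ 8 * Y → Y ≤ X ^ σ →
      (Set.ncard {x : ℤ × ℤ | x.1 ≠ 0 ∧ x.2 ≠ 0 ∧ x.1 ^ 3 ≠ x.2 ^ 2 ∧ (1728 : ℤ) ∣ x.1 ^ 3 - x.2 ^ 2 ∧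
          ((∀ p : ℕ, p.Prime → 5 ≤ p → ¬ ((p : ℤ) ^ 4 ∣ x.1 ∧ (p : ℤ) ^ 6 ∣ x.2)) ∧
            ¬ ((2 : ℤ) ^ 8 ∣ x.1 ∧ (2 : ℤ) ^ 11 ∣ x.2) ∧ ¬ ((3 : ℤ) ^ 5 ∣ x.1 ∧ (3 : ℤ) ^ 9 ∣ x.2)) ∧
          ((|x.1| ^ 3 : ℤ) : ℝ) ≤ Y ∧ ((|x.1 ^ 3 - x.2 ^ 2| : ℤ) : ℝ) ≤ 1728 * Y ∧
          Y < 2 * max (((|x.1| ^ 3 : ℤ) : ℝ)) (((|x.1 ^ 3 - x.2 ^ 2| : ℤ) : ℝ) / 1728) ∧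
          ((∏ p ∈ ((x.1 ^ 3 - x.2 ^ 2) / 1728).natAbs.primeFactors,
              (if ((p : ℕ) : ℤ) ∣ x.1 then p ^ 2 else p) : ℕ) : ℝ) ≤ X} : ℝ) ≤
        C * X ^ ε * (X * Y ^ (-(1 / 6 : ℝ)) + 1)) →
      ∀ κ σ ε : ℝ, 3 < κ → κ < 6 → 6 < σ → 0 < ε → ∃ C : ℝ, ∀ X : ℝ, 1 ≤ X →
        (Set.ncard {W₀ : WeierstrassCurve ℤ | (W₀.baseChange ℚ).IsElliptic ∧
            (∀ v : IsDedekindDomain.HeightOneSpectrum ℤ, (W₀.baseChange ℚ).IsMinimalAt v) ∧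
            (W₀.a₁ = 0 ∨ W₀.a₁ = 1) ∧ (W₀.a₃ = 0 ∨ W₀.a₃ = 1) ∧ (W₀.a₂ = -1 ∨ W₀.a₂ = 0 ∨ W₀.a₂ = 1) ∧
            W₀.c₄ ≠ 0 ∧ W₀.c₆ ≠ 0 ∧ (((W₀.baseChange ℚ).conductorNorm ℤ : ℕ) : ℝ) ≤ X ∧
            (((W₀.baseChange ℚ).conductorNorm ℤ : ℕ) : ℝ) ^ κ ≤ ((max |W₀.Δ| (|W₀.c₄| ^ 3) : ℤ) : ℝ) ∧
            ((max |W₀.Δ| (|W₀.c₄| ^ 3) : ℤ) : ℝ) ≤ (((W₀.baseChange ℚ).conductorNorm ℤ : ℕ) : ℝ) ^ σ} : ℝ) ≤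
          C * X ^ (1 - κ / 6 + ε) := by
  intro hlaw κ σ ε hκ3 hκ6 hσ6 hε
  have hκ0 : 0 < κ := by linarith
  have hσ0 : 0 ≤ σ := by linarith
  have hσ1 : 6 < σ + 1 := by linarith
  have hε2 : 0 < ε / 2 := by positivity
  have hexp0 : 0 ≤ 1 - κ / 6 + ε := by linarith
  obtain ⟨C, hC⟩ := hlaw (σ + 1) hσ1 (ε / 2) hε2
  set C₀ : ℝ := max C 0 with hC₀
  have hC₀0 : 0 ≤ C₀ := le_max_right _ _
  refine ⟨(2 : ℝ) ^ (1 - κ / 6 + ε) * (12 * (3 * C₀) * (2 * σ / (ε * Real.log 2) + 1)), fun X hX => ?_⟩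
  have hX0 : 0 < X := by linarith
  -- enlarge `X` to `X' = max X 2 ≥ 2`
  set X' : ℝ := max X 2 with hX'
  have hXX' : X ≤ X' := le_max_left _ _
  have hX'2 : 2 ≤ X' := le_max_right _ _
  have hX'1 : 1 ≤ X' := by linarith
  have hX'0 : 0 < X' := by linarith
  have hX'X : X' ≤ 2 * X := max_le (by linarith) (by linarith)
  -- the shells
  set J : ℕ := Nat.log 2 ⌊X' ^ σ⌋₊ with hJ
  set Xj : ℕ → ℝ := fun j => min X' ((2 : ℝ) ^ (((j + 1 : ℕ) : ℝ) / κ)) with hXj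
  set Yj : ℕ → ℝ := fun j => 2 * (2 : ℝ) ^ j - 1 with hYj
  set S : ℕ → Set (ℤ × ℤ) := fun j =>
    {x : ℤ × ℤ | x.1 ≠ 0 ∧ x.2 ≠ 0 ∧ x.1 ^ 3 ≠ x.2 ^ 2 ∧ (1728 : ℤ) ∣ x.1 ^ 3 - x.2 ^ 2 ∧
      ((∀ p : ℕ, p.Prime → 5 ≤ p → ¬ ((p : ℤ) ^ 4 ∣ x.1 ∧ (p : ℤ) ^ 6 ∣ x.2)) ∧
        ¬ ((2 : ℤ) ^ 8 ∣ x.1 ∧ (2 : ℤ) ^ 11 ∣ x.2) ∧ ¬ ((3 : ℤ) ^ 5 ∣ x.1 ∧ (3 : ℤ) ^ 9 ∣ x.2)) ∧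
      ((|x.1| ^ 3 : ℤ) : ℝ) ≤ Yj j ∧ ((|x.1 ^ 3 - x.2 ^ 2| : ℤ) : ℝ) ≤ 1728 * Yj j ∧
      Yj j < 2 * max (((|x.1| ^ 3 : ℤ) : ℝ)) (((|x.1 ^ 3 - x.2 ^ 2| : ℤ) : ℝ) / 1728) ∧
      ((∏ p ∈ ((x.1 ^ 3 - x.2 ^ 2) / 1728).natAbs.primeFactors,
          (if ((p : ℕ) : ℤ) ∣ x.1 then p ^ 2 else p) : ℕ) : ℝ) ≤ Xj j} with hS
  have h2j1 : ∀ j : ℕ, (1 : ℝ) ≤ (2 : ℝ) ^ j := fun j => one_le_pow₀ (by norm_num)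
  have hYj1 : ∀ j : ℕ, 1 ≤ Yj j := fun j => by simp only [hYj]; linarith [h2j1 j]
  have hYj2 : ∀ j : ℕ, (2 : ℝ) ^ j ≤ Yj j := fun j => by simp only [hYj]; linarith [h2j1 j]
  have hYj3 : ∀ j : ℕ, Yj j < 2 * (2 : ℝ) ^ j := fun j => by simp only [hYj]; linarith
  set T : Finset (ℤ × ℤ × ℤ) := ({0, 1} : Finset ℤ) ×ˢ (({-1, 0, 1} : Finset ℤ) ×ˢ ({0, 1} : Finset ℤ))
    with hT
  set U : Set (ℤ × ℤ) := ⋃ j ∈ Finset.range (J + 1), S j with hU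
  have hfin : ((↑T : Set (ℤ × ℤ × ℤ)) ×ˢ U).Finite :=
    T.finite_toSet.prod (Set.Finite.biUnion (Finset.range (J + 1)).finite_toSet
      fun j _ => cuspSetD_finite (Xj j) (Yj j) (hYj1 j))
  -- Step 1: the window maps injectively into `T × U`
  have hmaps : ∀ W : WeierstrassCurve ℤ, W ∈ {W₀ : WeierstrassCurve ℤ | (W₀.baseChange ℚ).IsElliptic ∧
      (∀ v : IsDedekindDomain.HeightOneSpectrum ℤ, (W₀.baseChange ℚ).IsMinimalAt v) ∧
      (W₀.a₁ = 0 ∨ W₀.a₁ = 1) ∧ (W₀.a₃ = 0 ∨ W₀.a₃ = 1) ∧ (W₀.a₂ = -1 ∨ W₀.a₂ = 0 ∨ W₀.a₂ = 1) ∧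
      W₀.c₄ ≠ 0 ∧ W₀.c₆ ≠ 0 ∧ (((W₀.baseChange ℚ).conductorNorm ℤ : ℕ) : ℝ) ≤ X ∧
      (((W₀.baseChange ℚ).conductorNorm ℤ : ℕ) : ℝ) ^ κ ≤ ((max |W₀.Δ| (|W₀.c₄| ^ 3) : ℤ) : ℝ) ∧
      ((max |W₀.Δ| (|W₀.c₄| ^ 3) : ℤ) : ℝ) ≤ (((W₀.baseChange ℚ).conductorNorm ℤ : ℕ) : ℝ) ^ σ} →
      ((W.a₁, W.a₂, W.a₃), (W.c₄, W.c₆)) ∈ (↑T : Set (ℤ × ℤ × ℤ)) ×ˢ U := by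
    intro W hW
    obtain ⟨hE, hmin, h₁, h₃, h₂, hc₄, hc₆, hNX, hlo, hhi⟩ := hW
    refine Set.mk_mem_prod ?_ ?_
    · simp only [hT, Finset.coe_product, Finset.coe_insert, Finset.coe_singleton, Set.mem_prod,
        Set.mem_insert_iff, Set.mem_singleton_iff]
      exact ⟨h₁, h₂, h₃⟩
    · have hNX' : (((W.baseChange ℚ).conductorNorm ℤ : ℕ) : ℝ) ≤ X' := hNX.trans hXX'
      -- `N ≤ X_j` is the last clause of the sister shell membership
      obtain ⟨-, -, -, -, -, -, -, hN5⟩ := mem_cuspShell_of_window hκ0 hmin hc₄ hc₆ hNX' hlo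
      have hjJ := log_Mcusp_le hσ0 hNX' hhi
      set M : ℕ := Mcusp (W.c₄, W.c₆) with hM
      set j : ℕ := Nat.log 2 M with hj
      have hM0 : M ≠ 0 := by
        have h1 : 1 ≤ W.c₄.natAbs ^ 3 := Nat.one_le_pow _ _ (Int.natAbs_pos.mpr hc₄)
        have h2 : W.c₄.natAbs ^ 3 ≤ M := le_max_right _ _
        omega
      have hlow : (2 : ℝ) ^ j ≤ (M : ℝ) := by exact_mod_cast Nat.pow_log_le_self 2 hM0
      have hupp : (M : ℝ) + 1 ≤ 2 * (2 : ℝ) ^ j := by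
        have h := Nat.lt_pow_succ_log_self (b := 2) (by norm_num) M
        have h' : ((M + 1 : ℕ) : ℝ) ≤ ((2 ^ (j + 1) : ℕ) : ℝ) := by exact_mod_cast h
        push_cast at h'
        simpa [pow_succ, mul_comm] using h'
      have hMY : (M : ℝ) ≤ Yj j := by simp only [hYj]; linarith
      have hYM : Yj j < 2 * (M : ℝ) := by simp only [hYj]; linarith
      -- `N ≤ X_j`: `N ≤ X ≤ X'` and `N^κ ≤ M < 2^{j+1}`
      have hN1 : (1 : ℝ) ≤ (((W.baseChange ℚ).conductorNorm ℤ : ℕ) : ℝ) := by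
        exact_mod_cast conductorNorm_pos_holds (W.baseChange ℚ)
      have hMreal : ((M : ℕ) : ℝ) = ((max |W.Δ| (|W.c₄| ^ 3) : ℤ) : ℝ) := cast_Mcusp_eq W
      have hNκ : (((W.baseChange ℚ).conductorNorm ℤ : ℕ) : ℝ) ^ κ < (2 : ℝ) ^ (((j + 1 : ℕ) : ℝ)) := by
        rw [Real.rpow_natCast, pow_succ, mul_comm]
        exact lt_of_le_of_lt (hlo.trans_eq hMreal.symm) (by linarith)
      have hNle : (((W.baseChange ℚ).conductorNorm ℤ : ℕ) : ℝ) ≤ (2 : ℝ) ^ (((j + 1 : ℕ) : ℝ) / κ) := by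
        have hN0 : (0 : ℝ) ≤ (((W.baseChange ℚ).conductorNorm ℤ : ℕ) : ℝ) := by linarith
        have h1 : ((((W.baseChange ℚ).conductorNorm ℤ : ℕ) : ℝ) ^ κ) ^ (1 / κ) ≤
            ((2 : ℝ) ^ (((j + 1 : ℕ) : ℝ))) ^ (1 / κ) :=
          Real.rpow_le_rpow (Real.rpow_nonneg hN0 κ) hNκ.le (by positivity)
        rw [← Real.rpow_mul hN0, mul_one_div_cancel hκ0.ne', Real.rpow_one, ← Real.rpow_mul (by norm_num)]
          at h1
        rwa [div_eq_mul_one_div]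
      have hNXj : (((W.baseChange ℚ).conductorNorm ℤ : ℕ) : ℝ) ≤ Xj j := le_min hNX' hNle
      rw [hU]
      simp only [Set.mem_iUnion, Finset.mem_range]
      exact ⟨j, Nat.lt_succ_of_le hjJ, mem_cuspSetD_of_window hmin hc₄ hc₆ hNXj hMY hYM⟩
  have h1 := Set.ncard_le_ncard_of_injOn (fun W : WeierstrassCurve ℤ => ((W.a₁, W.a₂, W.a₃), (W.c₄, W.c₆)))
    hmaps (model_injective.injOn) hfin
  have h2 : ((↑T : Set (ℤ × ℤ × ℤ)) ×ˢ U).ncard = 12 * U.ncard := by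
    rw [Set.ncard_prod, Set.ncard_coe_finset, card_reducedTriples]
  have h3 : U.ncard ≤ ∑ j ∈ Finset.range (J + 1), (S j).ncard :=
    Finset.set_ncard_biUnion_le _ _
  -- Step 2: the per-shell bound
  have hXpow1 : 1 ≤ X' ^ (1 - κ / 6) := Real.one_le_rpow hX'1 (by linarith)
  have hshell : ∀ j ∈ Finset.range (J + 1),
      ((S j).ncard : ℝ) ≤ 3 * C₀ * X' ^ (ε / 2) * X' ^ (1 - κ / 6) := by
    intro j hj
    have hjJ : j ≤ J := Nat.lt_succ_iff.mp (Finset.mem_range.mp hj)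
    have hXj1 : 1 ≤ Xj j := le_min hX'1 (Real.one_le_rpow (by norm_num) (by positivity))
    have hXjX : Xj j ≤ X' := min_le_left _ _
    have hXj0 : 0 ≤ Xj j := by linarith
    have h2jσ : (2 : ℝ) ^ j ≤ X' ^ σ := by
      have hfl0 : ⌊X' ^ σ⌋₊ ≠ 0 := by
        have : 1 ≤ ⌊X' ^ σ⌋₊ := Nat.le_floor (by exact_mod_cast Real.one_le_rpow hX'1 hσ0)
        omega
      have hA : ((2 ^ J : ℕ) : ℝ) ≤ (⌊X' ^ σ⌋₊ : ℝ) := by exact_mod_cast Nat.pow_log_le_self 2 hfl0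
      push_cast at hA
      calc (2 : ℝ) ^ j ≤ (2 : ℝ) ^ J := pow_le_pow_right₀ (by norm_num) hjJ
        _ ≤ ⌊X' ^ σ⌋₊ := hA
        _ ≤ X' ^ σ := Nat.floor_le (by positivity)
    -- the two cone conditions at `(X_j, Y_j)`
    set A : ℝ := (2 : ℝ) ^ (((j + 1 : ℕ) : ℝ) / κ) with hA
    have hA1 : 1 ≤ A := Real.one_le_rpow (by norm_num) (by positivity)
    have hAκ : A ^ κ = 2 * (2 : ℝ) ^ j := by
      rw [hA, ← Real.rpow_mul (by norm_num), div_mul_cancel₀ _ hκ0.ne', Real.rpow_natCast, pow_succ, mul_comm]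
    have hXjA : Xj j ≤ A := min_le_right _ _
    have hcone1 : Xj j ^ 3 ≤ 8 * Yj j := by
      calc Xj j ^ 3 = Xj j ^ ((3 : ℕ) : ℝ) := (Real.rpow_natCast _ 3).symm
        _ ≤ Xj j ^ κ := Real.rpow_le_rpow_of_exponent_le hXj1 (by norm_num; linarith)
        _ ≤ A ^ κ := Real.rpow_le_rpow hXj0 hXjA hκ0.le
        _ = 2 * (2 : ℝ) ^ j := hAκ
        _ ≤ 8 * Yj j := by linarith [hYj2 j, h2j1 j]
    have hcone2 : Yj j ≤ Xj j ^ (σ + 1) := by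
      rcases min_cases X' A with ⟨hmin, -⟩ | ⟨hmin, -⟩
      · simp only [hXj] at hmin ⊢
        rw [hmin, Real.rpow_add hX'0, Real.rpow_one]
        calc Yj j ≤ 2 * (2 : ℝ) ^ j := (hYj3 j).le
          _ ≤ X' ^ σ * 2 := by linarith [h2jσ]
          _ ≤ X' ^ σ * X' := mul_le_mul_of_nonneg_left hX'2 (by positivity)
      · simp only [hXj] at hmin ⊢
        rw [hmin]
        calc Yj j ≤ 2 * (2 : ℝ) ^ j := (hYj3 j).le
          _ = A ^ κ := hAκ.symm
          _ ≤ A ^ (σ + 1) := Real.rpow_le_rpow_of_exponent_le hA1 (by linarith)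
    have hb := hC (Xj j) (Yj j) hXj1 (hYj1 j) hcone1 hcone2
    -- `X_j^{ε/2} ≤ X'^{ε/2}`
    have hloss : Xj j ^ (ε / 2) ≤ X' ^ (ε / 2) := Real.rpow_le_rpow hXj0 hXjX hε2.le
    -- main term
    have hmain : Xj j * Yj j ^ (-(1 / 6 : ℝ)) + 1 ≤ 3 * X' ^ (1 - κ / 6) := by
      have h6 : Yj j ^ (-(1 / 6 : ℝ)) ≤ ((2 : ℝ) ^ j) ^ (-(1 / 6 : ℝ)) :=
        Real.rpow_le_rpow_of_nonpos (by positivity) (hYj2 j) (by norm_num)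
      have h7 : Xj j * Yj j ^ (-(1 / 6 : ℝ)) ≤ Xj j * ((2 : ℝ) ^ j) ^ (-(1 / 6 : ℝ)) :=
        mul_le_mul_of_nonneg_left h6 hXj0
      have h8 := shell_main_le hκ0 hκ6.le hX'1 j
      linarith
    have hnn1 : 0 ≤ Xj j * Yj j ^ (-(1 / 6 : ℝ)) + 1 :=
      add_nonneg (mul_nonneg hXj0 (Real.rpow_nonneg (by linarith [hYj1 j]) _)) zero_le_one
    have hnn : 0 ≤ Xj j ^ (ε / 2) * (Xj j * Yj j ^ (-(1 / 6 : ℝ)) + 1) :=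
      mul_nonneg (Real.rpow_nonneg hXj0 _) hnn1
    calc ((S j).ncard : ℝ)
        ≤ C * Xj j ^ (ε / 2) * (Xj j * Yj j ^ (-(1 / 6 : ℝ)) + 1) := hb
      _ ≤ C₀ * (Xj j ^ (ε / 2) * (Xj j * Yj j ^ (-(1 / 6 : ℝ)) + 1)) := by
          rw [mul_assoc]; exact mul_le_mul_of_nonneg_right (le_max_left _ _) hnn
      _ ≤ C₀ * (X' ^ (ε / 2) * (3 * X' ^ (1 - κ / 6))) := by
          apply mul_le_mul_of_nonneg_left _ hC₀0
          exact mul_le_mul hloss hmain hnn1 (by positivity)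
      _ = 3 * C₀ * X' ^ (ε / 2) * X' ^ (1 - κ / 6) := by ring
  -- Step 3: assemble
  have hcount := card_shells_le hσ0 hε hX'1
  have hK0 : 0 ≤ 12 * (3 * C₀) * (2 * σ / (ε * Real.log 2) + 1) := by
    have hlog2 : 0 < Real.log 2 := Real.log_pos (by norm_num)
    positivity
  have hX'pow : X' ^ (1 - κ / 6 + ε) ≤ (2 : ℝ) ^ (1 - κ / 6 + ε) * X ^ (1 - κ / 6 + ε) := by
    rw [← Real.mul_rpow (by norm_num) hX0.le]
    exact Real.rpow_le_rpow hX'0.le hX'X hexp0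
  calc (Set.ncard {W₀ : WeierstrassCurve ℤ | (W₀.baseChange ℚ).IsElliptic ∧
          (∀ v : IsDedekindDomain.HeightOneSpectrum ℤ, (W₀.baseChange ℚ).IsMinimalAt v) ∧
          (W₀.a₁ = 0 ∨ W₀.a₁ = 1) ∧ (W₀.a₃ = 0 ∨ W₀.a₃ = 1) ∧ (W₀.a₂ = -1 ∨ W₀.a₂ = 0 ∨ W₀.a₂ = 1) ∧
          W₀.c₄ ≠ 0 ∧ W₀.c₆ ≠ 0 ∧ (((W₀.baseChange ℚ).conductorNorm ℤ : ℕ) : ℝ) ≤ X ∧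
          (((W₀.baseChange ℚ).conductorNorm ℤ : ℕ) : ℝ) ^ κ ≤ ((max |W₀.Δ| (|W₀.c₄| ^ 3) : ℤ) : ℝ) ∧
          ((max |W₀.Δ| (|W₀.c₄| ^ 3) : ℤ) : ℝ) ≤ (((W₀.baseChange ℚ).conductorNorm ℤ : ℕ) : ℝ) ^ σ} : ℝ)
      ≤ (((↑T : Set (ℤ × ℤ × ℤ)) ×ˢ U).ncard : ℝ) := by exact_mod_cast h1
    _ = 12 * (U.ncard : ℝ) := by rw [h2]; push_cast; ring
    _ ≤ 12 * ∑ j ∈ Finset.range (J + 1), ((S j).ncard : ℝ) := by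
        have : (U.ncard : ℝ) ≤ ∑ j ∈ Finset.range (J + 1), ((S j).ncard : ℝ) := by
          exact_mod_cast h3
        linarith
    _ ≤ 12 * ∑ _j ∈ Finset.range (J + 1), 3 * C₀ * X' ^ (ε / 2) * X' ^ (1 - κ / 6) := by
        gcongr with j hj
        exact hshell j hj
    _ = 12 * (((J + 1 : ℕ) : ℝ) * (3 * C₀ * X' ^ (ε / 2) * X' ^ (1 - κ / 6))) := by
        rw [Finset.sum_const, Finset.card_range, nsmul_eq_mul]
    _ ≤ 12 * (((2 * σ / (ε * Real.log 2) + 1) * X' ^ (ε / 2)) * (3 * C₀ * X' ^ (ε / 2) * X' ^ (1 - κ / 6))) := by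
        gcongr
    _ = 12 * (3 * C₀) * (2 * σ / (ε * Real.log 2) + 1) * (X' ^ (ε / 2) * X' ^ (ε / 2) * X' ^ (1 - κ / 6)) := by
        ring
    _ = 12 * (3 * C₀) * (2 * σ / (ε * Real.log 2) + 1) * X' ^ (1 - κ / 6 + ε) := by
        rw [← Real.rpow_add hX'0, ← Real.rpow_add hX'0]
        congr 2
        ring
    _ ≤ 12 * (3 * C₀) * (2 * σ / (ε * Real.log 2) + 1) * ((2 : ℝ) ^ (1 - κ / 6 + ε) * X ^ (1 - κ / 6 + ε)) :=
        mul_le_mul_of_nonneg_left hX'pow hK0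
    _ = (2 : ℝ) ^ (1 - κ / 6 + ε) * (12 * (3 * C₀) * (2 * σ / (ε * Real.log 2) + 1)) *
          X ^ (1 - κ / 6 + ε) := by ring

end Summit.ABC.ABC.Theorems.SharpModerateLaw.DeepModuli

end
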